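import Summits.QuantumFields.YangMills.Theorems.FluctuationComparisonRegPrIntLOrganTangentNearFamilyStability
import Summits.QuantumFields.YangMills.Theorems.FluctuationComparisonRegPrIntLOrganTangentFibreWeightSquareIntegrability
import HarnessLib

/-!
# Crux `FluctuationComparisonRegPrIntL` (stmt-QuantumFields-20520, rung R3), PATH-B organ, H-currency cone — (L38) «REG′ OF ALL FOUR (I-law) BLOCKS FROM ONE UNIFORM
# WEIGHT-LIPSCHITZ LETTER (W-Lip)»: the regularity halves REG′ of the A2′ (I-law) blocks of row-sq v0.3 (`Cruxes/…/DischargeInputsHJsq.lean` e71caa78; texts = the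
# `hIlawX ∕ hIlawL ∕ hIlawV3 ∕ hIlawV4` binders of ✓`…OrganTangentLawClausesOfILawAE`) from ONE displayed letter on the interpolated weight alone + the frame + (I-geo)sq

Cell `ym3-torus` (YM ladder rung R3 = continuum `SU(2)` Yang–Mills on the three-torus — a RUNG: NOT d = 4, NOT infinite volume, NOT a mass gap, NOT Clay).
Width seat `ym-ust-20520-w5` (gen 25), `--kind proof --supports stmt-QuantumFields-20520 --as helper`, count-neutral, DEFINITION-FREE, default heartbeats,
no registry ∕ binder ∕ `Lines/` edit.  Over ✓p819252 `…NearStability` (`hstab_of_near`, `guard8_of_guard16`), ✓p819195 `…NearDisplacement` (`dist1_chart_le_rel`,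
`norm_smul_le_of_abs_le_one`), ✓p820913 `…NearFamilyStability` (import hub; ✓`expPt_add_smul`), ✓p817898 `…RelPathWindow` (`plaqSmall_relPath_of_le`,
`plaqSmall_relSquare_of_le`), ✓p815882 `…FibreWeightSquareIntegrability` (`abs_logRatio_le_of_plaq_le`).

WHY (DISCHARGE-SPEC v1.5 §D3 «the score needs `∂_s` of `χ∘Φ`, `ρ^t∘Φ`, `ρ′^{1−t}∘Φ`, `J` along the coarse move: D0's differentiability of the chart»; px19 g21 UV3-NODE §73 (G0-e)
«REG is chart analyticity»).  Each A2′ block of the row reads, per admissible path ∕ square, `REG′ ∧ KER′` with REG′ = «integrable a.e.-Lipschitz moduli of `s ↦ wNum_t (X s) z`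
and of its products with the block's `s`-INDEPENDENT observables (`ΔF`, `ΣF`, `ΔF·ΣF`, `F`, `F²` at fixed corners) on `Set.Ioo (-1) 2`».  This file proves REG′ for all four
blocks from ONE letter that mentions NO observable and NO `z`-dependence:

* (W-Lip) «the interpolated weight is UNIFORMLY Lipschitz along near relational one-bond paths (and along the `s`-edges of near relational squares)»: a real `bW` with, for every
  near relational `B′`-path `X` from a `θ_j∕4`-corner `U₂` (`‖m′‖ ≤ rc·θ_j∕4`), `∀ᵐ z ∂τ, LipschitzOnWith (Real.nnabs bW) (fun s => wNum … t (X s) z) (Set.Ioo (-1) 2)`; squares: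
  the same along `s ↦ X s s′` for every `s′ ∈ Icc 0 1`.  It is what the D0 «MINIMISER CHART» typer hands over (compact window × compact fibre ⇒ uniform moduli); a
  `z`-dependent integrable edition is a later weakening if wanted.

HOW.  §0 [folklore] `lipschitzOnWith_const_mul_of_support`: an `s`-independent multiplier `G` is harmless — if the weight vanishes along the whole interval the product is `≡ 0`,
else `|G| ≤ M` gives the modulus `M·bW`.  §1 NEAR STABILITY FROM LAW POINTS WITH `|s| ≤ 2` (new): REG′'s Lipschitz window is `Set.Ioo (-1) 2`, not `Icc 0 1`, so a law point
`X s₀` reaches the path's base in TWO half-moves (`relPath_half_step`, ✓`expPt_add_smul`; each of size `≤ rc·θ_j∕4`) = 2 room units, and the second value corner in one more —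
EXACTLY the row's room₃ `24∕25·θ_Ts + 3·(Db·rc) ≤ c·θ_Ts` (`k = 3`), no new (I-geo) letter: `hstab_relPath_two_of_hdisp` (paths; value corners `V₁` and `U₁`),
`hstab_relSquare_two_of_hdisp` (squares; value corner `V00`).  With ✓`abs_logRatio_le_of_plaq_le` every multiplier is then bounded on the path support by `2M`, `(2M)²`, `M`,
`M²`.  §2 the dischargers ★★`ilawRegX_of_weightLip` ((I-law-X)sq: `b, bΔ`), ★★`ilawRegV3_of_weightLip` ((I-law-V3)sq: `b, bD, bS, bDS`), ★★`ilawRegSq_of_weightLip`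
((I-law-L) AND (I-law-V4), identical REG′ shape: `b, bF, bFF`) — conclusions = the REG′ conjunct texts VERBATIM under the blocks' own path ∕ square binders, moduli CONSTANT
(`Integrable` on the finite fibre measure).  No row text changes (REG′ ∧ KER′ stay conjuncts; a discharger composes `⟨ilawReg…, KER′⟩`); no edition needed.

HONEST FRAMING: a door between HYPOTHESIS texts + [folklore] calculus; (W-Lip) is exactly as OPEN as REG′ (weaker only in carrying no observable and one constant); nothing of
Bałaban's analysis is asserted or proved; KER′, (I-curv), (I-cov), `hdisp` untouched and OPEN; `OrganDischargeInputsHJ(sq)` ∕ `SpreadFibreLawH(J)(sq)` UNDISCHARGED; the five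
registered stubs of `Lines/semiclassical_s2beta.lean`, crux 20520 and `YM3TorusSU2` are NOT proved; registry untouched; rung R3 = SU(2) YM₃ on T³ at fixed lattice data —
NOT d = 4, NOT infinite volume, NOT a mass gap, NOT Clay; the Yang–Mills mass gap is NOT proved.  [folklore]
-/

set_option autoImplicit false

noncomputable section

namespace Summit.QuantumFields.YangMills.Theorems.OrganTangentILawRegOfWeightLip

open MeasureTheory Filter Topology Set Function
open scoped ENNReal NNReal
open Literature.MathematicalPhysics.QuantumFieldTheory.Balaban1983to89 T3ContinuumYM3Torus T3NestedUnitLaws T3UnitLawDensityEML T4Continuum BalabanUVClass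
  T3UnitScaleTilt T3LevelShift T3TiltDescent
open T4CubeChartExp (expPt)
open Summit.QuantumFields.YangMills.Theorems.FluctuationComparisonRegPrIntLRunpairOrganFibreLaw (mwCut wNum)
open Summit.QuantumFields.YangMills.Theorems.OrganTangentILawKnitFacts (plaqSmall_mono abs_le_two_of_mem_Icc)
open Summit.QuantumFields.YangMills.Theorems.OrganTangentRelPathWindow (plaqSmall_relPath_of_le plaqSmall_relSquare_of_le)
open Summit.QuantumFields.YangMills.Theorems.OrganTangentNearDisplacement (dist1_chart_le_rel norm_smul_le_of_abs_le_one abs_le_one_of_mem_Icc)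
open Summit.QuantumFields.YangMills.Theorems.OrganTangentNearStability (hstab_of_near guard8_of_guard16)
open Summit.QuantumFields.YangMills.Theorems.OrganTangentSmallStepWindowPath (expPt_add_smul)
open Summit.QuantumFields.YangMills.Theorems.OrganTangentFibreWeightSquareIntegrability (abs_logRatio_le_of_plaq_le)

/-! ## §0 Folklore: an `s`-independent multiplier on the support of a Lipschitz weight -/

section Folklore

/-- If `f` is Lipschitz on `S` with modulus `|K|` and the constant multiplier `G` is bounded by `M` AS SOON AS `f` does not vanish identically on `S`, then `s ↦ G·f s` is
Lipschitz on `S` with modulus `|M·K|`. [folklore] -/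
theorem lipschitzOnWith_const_mul_of_support {K G M : ℝ} {f : ℝ → ℝ} {S : Set ℝ}
    (hf : LipschitzOnWith (Real.nnabs K) f S) (hM : (∃ s ∈ S, f s ≠ 0) → |G| ≤ M) :
    LipschitzOnWith (Real.nnabs (M * K)) (fun s => G * f s) S := by
  rw [lipschitzOnWith_iff_dist_le_mul] at hf ⊢
  intro x hx y hy
  rw [Real.dist_eq, Real.coe_nnabs]
  by_cases hne : ∃ s ∈ S, f s ≠ 0
  · have hG := hM hne
    have h1 := hf x hx y hy
    rw [Real.dist_eq, Real.coe_nnabs] at h1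
    rw [← mul_sub, abs_mul, abs_mul, mul_assoc]
    exact mul_le_mul (hG.trans (le_abs_self M)) h1 (abs_nonneg _) (abs_nonneg _)
  · push Not at hne
    rw [hne x hx, hne y hy, sub_self, abs_zero]
    positivity

/-- `s ∈ Ioo (-1) 2 ⟹ |s| ≤ 2`. [folklore] -/
theorem abs_le_two_of_mem_Ioo {s : ℝ} (hs : s ∈ Set.Ioo (-1 : ℝ) 2) : |s| ≤ 2 :=
  abs_le.2 ⟨by linarith [hs.1], hs.2.le⟩

/-- `|s| ≤ 2 ⟹ |s ∕ 2| ≤ 1`. [folklore] -/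
theorem abs_half_le_one {s : ℝ} (hs : |s| ≤ 2) : |s / 2| ≤ 1 := by
  rw [abs_div, abs_two]; linarith

/-- `|s| ≤ 2 ⟹ |s ∕ 2| ≤ 2`. [folklore] -/
theorem abs_half_le_two {s : ℝ} (hs : |s| ≤ 2) : |s / 2| ≤ 2 := by
  rw [abs_div, abs_two]; linarith [abs_nonneg s]

end Folklore

/-! ## §1 The weight's support: the cut; relational half-steps; near stability from law points with `|s| ≤ 2` -/

section Support

variable (F : T3Family) (γ b₀ p₀ : ℝ) (j Ts : ℕ)
  (ρ ρ' : (i : ℕ) → GaugeField (F.P i) 0 ↥(Matrix.specialUnitaryGroup (Fin 2) ℂ) → ℝ) {Z : Type}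
  (Φ : GaugeField (F.P j) 0 ↥(Matrix.specialUnitaryGroup (Fin 2) ℂ) × Z → GaugeField (F.P Ts) 0 ↥(Matrix.specialUnitaryGroup (Fin 2) ℂ))
  (J : GaugeField (F.P j) 0 ↥(Matrix.specialUnitaryGroup (Fin 2) ℂ) × Z → ℝ≥0)

/-- Where the interpolated weight `wNum_t (V, z)` is non-zero, the cut `mwCut (Φ (V, z))` is non-zero. [folklore] -/
theorem mwCut_ne_zero_of_wNum_ne_zero (t : ℝ) (V : GaugeField (F.P j) 0 ↥(Matrix.specialUnitaryGroup (Fin 2) ℂ)) (z : Z)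
    (h : wNum F γ b₀ p₀ j Ts ρ ρ' Φ J t V z ≠ 0) : mwCut F γ b₀ p₀ j Ts (Φ (V, z)) ≠ 0 := by
  intro hχ
  apply h
  simp only [wNum, hχ, zero_mul]

end Support

section HalfStep

variable {P : Params} {i : ℕ}

/-- ★ **TWO HALF-MOVES**: on a relational `B′`-path `X` from `U` with direction `m′`, `X s` is the `(s∕2)•m′`-move of `X (s∕2)` (one-parameter subgroup law
✓`expPt_add_smul`). [folklore] -/
theorem relPath_half_step {U : GaugeField P i (Matrix.specialUnitaryGroup (Fin 2) ℂ)} {B' : PBond P i} {m' : Fin 3 → ℝ}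
    {X : ℝ → GaugeField P i (Matrix.specialUnitaryGroup (Fin 2) ℂ)}
    (hoff : ∀ s e, e ≠ B' → X s e = U e) (hon : ∀ s, X s B' = U B' * expPt (s • m')) (s : ℝ) :
    (∀ e, e ≠ B' → X s e = X (s / 2) e) ∧ X s B' = X (s / 2) B' * expPt ((s / 2) • m') := by
  refine ⟨fun e he => by rw [hoff s e he, hoff (s / 2) e he], ?_⟩
  rw [hon s, hon (s / 2), mul_assoc, ← expPt_add_smul, add_halves]

/-- The half-move has admissible size: `‖(s∕2)•m′‖ ≤ ‖m′‖` for `|s| ≤ 2`. [folklore] -/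
theorem norm_half_smul_le {s : ℝ} (hs : |s| ≤ 2) (m' : Fin 3 → ℝ) : ‖(s / 2) • m'‖ ≤ ‖m'‖ :=
  norm_smul_le_of_abs_le_one (abs_half_le_one hs) m'

end HalfStep

section NearTwo

/-- ★ **NEAR STABILITY, RELATIONAL LAW PATH, LAW PARAMETER `|s| ≤ 2`** (the REG′ window `Set.Ioo (-1) 2`): law point `X s` on the relational `B′`-path from the `θ_j∕4`-corner
`V₁ = U₁·e^m@B`; value corners `V₁` (two half-moves: 2 room units) AND `U₁` (one more: 3 units) both land in the closed `c·θ_Ts`-window wherever the cut at the law point is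
non-zero — under the row's guard `(1 + 16·√3·rc)·(θ_j∕4) ≤ θ_j` and room₃ `24∕25·θ_Ts + 3·(Db·rc) ≤ c·θ_Ts`, from `hdisp` alone. [folklore] -/
theorem hstab_relPath_two_of_hdisp (F : T3Family) (γ b₀ p₀ : ℝ) (j Ts : ℕ) (hjTs : j + 1 ≤ Ts)
    (hχsupp : ∀ U, mwCut F γ b₀ p₀ j Ts U ≠ 0 → ∀ (n : ℕ) (hjn : j + 1 ≤ n) (hnK : n ≤ Ts), PlaqSmall (24 / 25 * θBal F.L γ b₀ p₀ n) (descendTo F ℰp n Ts hnK U))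
    {Z : Type} (Φ : GaugeField (F.P j) 0 ↥(Matrix.specialUnitaryGroup (Fin 2) ℂ) × Z → GaugeField (F.P Ts) 0 ↥(Matrix.specialUnitaryGroup (Fin 2) ℂ))
    (hθj : 0 < θBal F.L γ b₀ p₀ j) (c Db rc : ℝ) (hrc : 0 ≤ rc) (hDb0 : 0 ≤ Db) (DP : Plaq (F.P Ts) 0 → PBond (F.P j) 0 → ℝ) (hDb : ∀ p b, DP p b ≤ Db)
    (hguard : (1 + 16 * Real.sqrt 3 * rc) * (θBal F.L γ b₀ p₀ j / 4) ≤ θBal F.L γ b₀ p₀ j)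
    (hdisp : ∀ (z : Z) (X : GaugeField (F.P j) 0 ↥(Matrix.specialUnitaryGroup (Fin 2) ℂ)), PlaqSmall (θBal F.L γ b₀ p₀ j) X →
      ∀ (b : PBond (F.P j) 0) (v : Fin 3 → ℝ), ‖v‖ ≤ rc * (θBal F.L γ b₀ p₀ j / 4) → ∀ s ∈ Icc (0 : ℝ) 1, ∀ p : Plaq (F.P Ts) 0,
        dist1 (GaugeField.plaqHol (Φ (update X b (X b * expPt (s • v)), z)) p)
          ≤ dist1 (GaugeField.plaqHol (Φ (X, z)) p) + DP p b * (‖v‖ / (θBal F.L γ b₀ p₀ j / 4)))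
    (hroom : 24 / 25 * θBal F.L γ b₀ p₀ Ts + 3 * (Db * rc) ≤ c * θBal F.L γ b₀ p₀ Ts) :
    ∀ (z : Z) (B B' : PBond (F.P j) 0) (m m' : Fin 3 → ℝ) (U₁ V₁ : GaugeField (F.P j) 0 ↥(Matrix.specialUnitaryGroup (Fin 2) ℂ))
      (X : ℝ → GaugeField (F.P j) 0 ↥(Matrix.specialUnitaryGroup (Fin 2) ℂ)), ‖m‖ ≤ rc * (θBal F.L γ b₀ p₀ j / 4) → ‖m'‖ ≤ rc * (θBal F.L γ b₀ p₀ j / 4) →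
      PlaqSmall (θBal F.L γ b₀ p₀ j / 4) U₁ → PlaqSmall (θBal F.L γ b₀ p₀ j / 4) V₁ → (∀ e, e ≠ B → V₁ e = U₁ e) → V₁ B = U₁ B * expPt m →
      (∀ s e, e ≠ B' → X s e = V₁ e) → (∀ s, X s B' = V₁ B' * expPt (s • m')) →
      ∀ s : ℝ, |s| ≤ 2 → mwCut F γ b₀ p₀ j Ts (Φ (X s, z)) ≠ 0 →
        (∀ p, dist1 (GaugeField.plaqHol (Φ (V₁, z)) p) ≤ c * θBal F.L γ b₀ p₀ Ts) ∧
        (∀ p, dist1 (GaugeField.plaqHol (Φ (U₁, z)) p) ≤ c * θBal F.L γ b₀ p₀ Ts) := by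
  intro z B B' m m' U₁ V₁ X hm hm' hU₁ hV₁ hVU hVB hoff hon s hs hχ
  have hθ4 : 0 < θBal F.L γ b₀ p₀ j / 4 := by positivity
  have hq : θBal F.L γ b₀ p₀ j / 4 ≤ θBal F.L γ b₀ p₀ j := by linarith
  have hg8 := guard8_of_guard16 hrc hθj.le hguard
  have hX2 : ∀ r : ℝ, |r| ≤ 2 → PlaqSmall (θBal F.L γ b₀ p₀ j) (X r) := fun r hr =>
    plaqSmall_mono hg8 (plaqSmall_relPath_of_le hV₁ hm' hoff hon hr)
  have hD : 0 ≤ Db * rc := mul_nonneg hDb0 hrc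
  obtain ⟨hhoff, hhon⟩ := relPath_half_step hoff hon s
  have hw : ‖(s / 2) • m'‖ ≤ rc * (θBal F.L γ b₀ p₀ j / 4) := (norm_half_smul_le hs m').trans hm'
  -- law point → midpoint → base → `U₁`
  have h1 : ∀ p, dist1 (GaugeField.plaqHol (Φ (X (s / 2), z)) p) ≤ dist1 (GaugeField.plaqHol (Φ (X s, z)) p) + Db * rc :=
    fun p => dist1_chart_le_rel hθ4 (fun X => Φ (X, z)) DP (hdisp z) hDb0 hDb hhoff hhon hw (hX2 s hs) p
  have h2 : ∀ p, dist1 (GaugeField.plaqHol (Φ (V₁, z)) p) ≤ dist1 (GaugeField.plaqHol (Φ (X (s / 2), z)) p) + Db * rc :=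
    fun p => dist1_chart_le_rel hθ4 (fun X => Φ (X, z)) DP (hdisp z) hDb0 hDb (hoff (s / 2)) (hon (s / 2)) hw (hX2 (s / 2) (abs_half_le_two hs)) p
  have h3 : ∀ p, dist1 (GaugeField.plaqHol (Φ (U₁, z)) p) ≤ dist1 (GaugeField.plaqHol (Φ (V₁, z)) p) + Db * rc :=
    fun p => dist1_chart_le_rel hθ4 (fun X => Φ (X, z)) DP (hdisp z) hDb0 hDb hVU hVB hm (plaqSmall_mono hq hV₁) p
  exact ⟨hstab_of_near F γ b₀ p₀ j Ts hjTs hχsupp Φ c (3 * (Db * rc)) hroom z V₁ (X s) (fun p => by linarith [h1 p, h2 p]) hχ,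
    hstab_of_near F γ b₀ p₀ j Ts hjTs hχsupp Φ c (3 * (Db * rc)) hroom z U₁ (X s) (fun p => by linarith [h1 p, h2 p, h3 p]) hχ⟩

/-- ★ **NEAR STABILITY, RELATIONAL LAW SQUARE, LAW PARAMETER `|s| ≤ 2`, `s′ ∈ Icc 0 1`**: law point `X s s′` (the `s′•m′`-move at `B′` of the `B`-path point `Y s` from the
`θ_j∕4`-corner `V00`); value corner `V00` (one move `X s s′ → Y s`, two half-moves `Y s → Y (s∕2) → V00`: 3 room units). [folklore] -/
theorem hstab_relSquare_two_of_hdisp (F : T3Family) (γ b₀ p₀ : ℝ) (j Ts : ℕ) (hjTs : j + 1 ≤ Ts)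
    (hχsupp : ∀ U, mwCut F γ b₀ p₀ j Ts U ≠ 0 → ∀ (n : ℕ) (hjn : j + 1 ≤ n) (hnK : n ≤ Ts), PlaqSmall (24 / 25 * θBal F.L γ b₀ p₀ n) (descendTo F ℰp n Ts hnK U))
    {Z : Type} (Φ : GaugeField (F.P j) 0 ↥(Matrix.specialUnitaryGroup (Fin 2) ℂ) × Z → GaugeField (F.P Ts) 0 ↥(Matrix.specialUnitaryGroup (Fin 2) ℂ))
    (hθj : 0 < θBal F.L γ b₀ p₀ j) (c Db rc : ℝ) (hrc : 0 ≤ rc) (hDb0 : 0 ≤ Db) (DP : Plaq (F.P Ts) 0 → PBond (F.P j) 0 → ℝ) (hDb : ∀ p b, DP p b ≤ Db)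
    (hguard : (1 + 16 * Real.sqrt 3 * rc) * (θBal F.L γ b₀ p₀ j / 4) ≤ θBal F.L γ b₀ p₀ j)
    (hdisp : ∀ (z : Z) (X : GaugeField (F.P j) 0 ↥(Matrix.specialUnitaryGroup (Fin 2) ℂ)), PlaqSmall (θBal F.L γ b₀ p₀ j) X →
      ∀ (b : PBond (F.P j) 0) (v : Fin 3 → ℝ), ‖v‖ ≤ rc * (θBal F.L γ b₀ p₀ j / 4) → ∀ s ∈ Icc (0 : ℝ) 1, ∀ p : Plaq (F.P Ts) 0,
        dist1 (GaugeField.plaqHol (Φ (update X b (X b * expPt (s • v)), z)) p)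
          ≤ dist1 (GaugeField.plaqHol (Φ (X, z)) p) + DP p b * (‖v‖ / (θBal F.L γ b₀ p₀ j / 4)))
    (hroom : 24 / 25 * θBal F.L γ b₀ p₀ Ts + 3 * (Db * rc) ≤ c * θBal F.L γ b₀ p₀ Ts) :
    ∀ (z : Z) (B B' : PBond (F.P j) 0) (m m' : Fin 3 → ℝ) (V00 : GaugeField (F.P j) 0 ↥(Matrix.specialUnitaryGroup (Fin 2) ℂ))
      (Y : ℝ → GaugeField (F.P j) 0 ↥(Matrix.specialUnitaryGroup (Fin 2) ℂ)) (X : ℝ → ℝ → GaugeField (F.P j) 0 ↥(Matrix.specialUnitaryGroup (Fin 2) ℂ)),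
      ‖m‖ ≤ rc * (θBal F.L γ b₀ p₀ j / 4) → ‖m'‖ ≤ rc * (θBal F.L γ b₀ p₀ j / 4) → PlaqSmall (θBal F.L γ b₀ p₀ j / 4) V00 →
      (∀ s e, e ≠ B → Y s e = V00 e) → (∀ s, Y s B = V00 B * expPt (s • m)) →
      (∀ s s' e, e ≠ B' → X s s' e = Y s e) → (∀ s s', X s s' B' = Y s B' * expPt (s' • m')) →
      ∀ s : ℝ, |s| ≤ 2 → ∀ s' ∈ Icc (0 : ℝ) 1, mwCut F γ b₀ p₀ j Ts (Φ (X s s', z)) ≠ 0 →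
        ∀ p, dist1 (GaugeField.plaqHol (Φ (V00, z)) p) ≤ c * θBal F.L γ b₀ p₀ Ts := by
  intro z B B' m m' V00 Y X hm hm' hV hYoff hYon hXoff hXon s hs s' hs' hχ
  have hθ4 : 0 < θBal F.L γ b₀ p₀ j / 4 := by positivity
  have hg8 := guard8_of_guard16 hrc hθj.le hguard
  have hY2 : ∀ r : ℝ, |r| ≤ 2 → PlaqSmall (θBal F.L γ b₀ p₀ j) (Y r) := fun r hr =>
    plaqSmall_mono hg8 (plaqSmall_relPath_of_le hV hm hYoff hYon hr)
  have hXss : PlaqSmall (θBal F.L γ b₀ p₀ j) (X s s') :=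
    plaqSmall_mono hguard (plaqSmall_relSquare_of_le hV hm hm' hYoff hYon hXoff hXon hs (abs_le_two_of_mem_Icc hs'))
  have hD : 0 ≤ Db * rc := mul_nonneg hDb0 hrc
  obtain ⟨hhoff, hhon⟩ := relPath_half_step hYoff hYon s
  have hw : ‖(s / 2) • m‖ ≤ rc * (θBal F.L γ b₀ p₀ j / 4) := (norm_half_smul_le hs m).trans hm
  have hw' : ‖s' • m'‖ ≤ rc * (θBal F.L γ b₀ p₀ j / 4) := (norm_smul_le_of_abs_le_one (abs_le_one_of_mem_Icc hs') m').trans hm'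
  -- law point `X s s′` → `Y s` → `Y (s∕2)` → `V00`
  have h1 : ∀ p, dist1 (GaugeField.plaqHol (Φ (Y s, z)) p) ≤ dist1 (GaugeField.plaqHol (Φ (X s s', z)) p) + Db * rc :=
    fun p => dist1_chart_le_rel hθ4 (fun X => Φ (X, z)) DP (hdisp z) hDb0 hDb (hXoff s s') (hXon s s') hw' hXss p
  have h2 : ∀ p, dist1 (GaugeField.plaqHol (Φ (Y (s / 2), z)) p) ≤ dist1 (GaugeField.plaqHol (Φ (Y s, z)) p) + Db * rc :=
    fun p => dist1_chart_le_rel hθ4 (fun X => Φ (X, z)) DP (hdisp z) hDb0 hDb hhoff hhon hw (hY2 s hs) p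
  have h3 : ∀ p, dist1 (GaugeField.plaqHol (Φ (V00, z)) p) ≤ dist1 (GaugeField.plaqHol (Φ (Y (s / 2), z)) p) + Db * rc :=
    fun p => dist1_chart_le_rel hθ4 (fun X => Φ (X, z)) DP (hdisp z) hDb0 hDb (hYoff (s / 2)) (hYon (s / 2)) hw (hY2 (s / 2) (abs_half_le_two hs)) p
  exact hstab_of_near F γ b₀ p₀ j Ts hjTs hχsupp Φ c (3 * (Db * rc)) hroom z V00 (X s s') (fun p => by linarith [h1 p, h2 p, h3 p]) hχ

end NearTwo

/-! ## §2 The REG′ halves of the four A2′ (I-law) blocks from (W-Lip) -/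

section Dischargers

/-- ★★ **REG′ OF THE (I-law-X)sq BLOCK FROM (W-Lip)** — under the block's own path binders (`B B′ m m′ U₁ V₁ W₂`, the nine admissibility hypotheses, the relational `B′`-path `X`
from `V₁`), the conjunct `∃ (b bΔ : Z → ℝ), Integrable b τ ∧ Integrable bΔ τ ∧ (∀ᵐ z, LipschitzOnWith |b z| (s ↦ wNum_t (X s) z) (Ioo (-1) 2)) ∧ (∀ᵐ z, LipschitzOnWith |bΔ z|
(s ↦ ΔF z·wNum_t (X s) z) (Ioo (-1) 2))` VERBATIM, with `b := bW`, `bΔ := (M + M)·bW` (`M` = ✓`abs_logRatio_le_of_plaq_le`'s bound on the closed `c·θ_Ts`-window). [folklore] -/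
theorem ilawRegX_of_weightLip (F : T3Family) (γ b₀ p₀ : ℝ) (j Ts : ℕ) (hjTs : j + 1 ≤ Ts)
    (ρ ρ' : (i : ℕ) → GaugeField (F.P i) 0 ↥(Matrix.specialUnitaryGroup (Fin 2) ℂ) → ℝ)
    (hρc : ContinuousOn (ρ Ts) {U | PlaqSmall (θBal F.L γ b₀ p₀ Ts) U}) (hρ'c : ContinuousOn (ρ' Ts) {U | PlaqSmall (θBal F.L γ b₀ p₀ Ts) U})
    (hρpos : ∀ U, PlaqSmall (θBal F.L γ b₀ p₀ Ts) U → 0 < ρ Ts U ∧ 0 < ρ' Ts U)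
    (hθ : 0 < θBal F.L γ b₀ p₀ Ts)
    (hχsupp : ∀ U, mwCut F γ b₀ p₀ j Ts U ≠ 0 → ∀ (n : ℕ) (hjn : j + 1 ≤ n) (hnK : n ≤ Ts), PlaqSmall (24 / 25 * θBal F.L γ b₀ p₀ n) (descendTo F ℰp n Ts hnK U))
    {Z : Type} [MeasurableSpace Z] (τ : Measure Z) [IsFiniteMeasure τ]
    (Φ : GaugeField (F.P j) 0 ↥(Matrix.specialUnitaryGroup (Fin 2) ℂ) × Z → GaugeField (F.P Ts) 0 ↥(Matrix.specialUnitaryGroup (Fin 2) ℂ))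
    (J : GaugeField (F.P j) 0 ↥(Matrix.specialUnitaryGroup (Fin 2) ℂ) × Z → ℝ≥0)
    (c : ℝ) (hc : c < 1)
    (hθj : 0 < θBal F.L γ b₀ p₀ j) (Db rc : ℝ) (hrc : 0 ≤ rc) (hDb0 : 0 ≤ Db) (DP : Plaq (F.P Ts) 0 → PBond (F.P j) 0 → ℝ) (hDb : ∀ p b, DP p b ≤ Db)
    (hguard : (1 + 16 * Real.sqrt 3 * rc) * (θBal F.L γ b₀ p₀ j / 4) ≤ θBal F.L γ b₀ p₀ j)
    (hdisp : ∀ (z : Z) (X : GaugeField (F.P j) 0 ↥(Matrix.specialUnitaryGroup (Fin 2) ℂ)), PlaqSmall (θBal F.L γ b₀ p₀ j) X →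
      ∀ (b : PBond (F.P j) 0) (v : Fin 3 → ℝ), ‖v‖ ≤ rc * (θBal F.L γ b₀ p₀ j / 4) → ∀ s ∈ Icc (0 : ℝ) 1, ∀ p : Plaq (F.P Ts) 0,
        dist1 (GaugeField.plaqHol (Φ (update X b (X b * expPt (s • v)), z)) p)
          ≤ dist1 (GaugeField.plaqHol (Φ (X, z)) p) + DP p b * (‖v‖ / (θBal F.L γ b₀ p₀ j / 4)))
    (hroom : 24 / 25 * θBal F.L γ b₀ p₀ Ts + 3 * (Db * rc) ≤ c * θBal F.L γ b₀ p₀ Ts) (t : ℝ) (bW : ℝ)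
    (hWlip : ∀ (B' : PBond (F.P j) 0) (m' : Fin 3 → ℝ) (U₂ : GaugeField (F.P j) 0 ↥(Matrix.specialUnitaryGroup (Fin 2) ℂ))
      (X : ℝ → GaugeField (F.P j) 0 ↥(Matrix.specialUnitaryGroup (Fin 2) ℂ)), ‖m'‖ ≤ rc * (θBal F.L γ b₀ p₀ j / 4) → PlaqSmall (θBal F.L γ b₀ p₀ j / 4) U₂ →
      (∀ s e, e ≠ B' → X s e = U₂ e) → (∀ s, X s B' = U₂ B' * expPt (s • m')) →
      ∀ᵐ z ∂τ, LipschitzOnWith (Real.nnabs bW) (fun s => wNum F γ b₀ p₀ j Ts ρ ρ' Φ J t (X s) z) (Set.Ioo (-1) 2)) :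
    ∀ (B B' : PBond (F.P j) 0) (m m' : Fin 3 → ℝ) (U₁ V₁ W₂ : GaugeField (F.P j) 0 ↥(Matrix.specialUnitaryGroup (Fin 2) ℂ)), ‖m‖ ≤ rc * (θBal F.L γ b₀ p₀ j / 4) → ‖m'‖ ≤ rc * (θBal F.L γ b₀ p₀ j / 4) → PlaqSmall (θBal F.L γ b₀ p₀ j / 4) U₁ → PlaqSmall (θBal F.L γ b₀ p₀ j / 4) V₁ → PlaqSmall (θBal F.L γ b₀ p₀ j / 4) W₂ → (∀ e, e ≠ B → V₁ e = U₁ e) → V₁ B = U₁ B * expPt m → (∀ e, e ≠ B' → W₂ e = V₁ e) → W₂ B' = V₁ B' * expPt m' → ∀ (X : ℝ → GaugeField (F.P j) 0 ↥(Matrix.specialUnitaryGroup (Fin 2) ℂ)), (∀ s e, e ≠ B' → X s e = V₁ e) → (∀ s, X s B' = V₁ B' * expPt (s • m')) →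
      (∃ (b bΔ : Z → ℝ), Integrable b τ ∧ Integrable bΔ τ ∧
        (∀ᵐ z ∂τ, LipschitzOnWith (Real.nnabs (b z)) (fun s => wNum F γ b₀ p₀ j Ts ρ ρ' Φ J t (X s) z) (Set.Ioo (-1) 2)) ∧
        (∀ᵐ z ∂τ, LipschitzOnWith (Real.nnabs (bΔ z)) (fun s => ((Real.log (ρ Ts (Φ (V₁, z))) - Real.log (ρ' Ts (Φ (V₁, z)))) - (Real.log (ρ Ts (Φ (U₁, z))) - Real.log (ρ' Ts (Φ (U₁, z))))) * wNum F γ b₀ p₀ j Ts ρ ρ' Φ J t (X s) z) (Set.Ioo (-1) 2))) := by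
  obtain ⟨M, hM⟩ := abs_logRatio_le_of_plaq_le F γ b₀ p₀ Ts (ρ Ts) (ρ' Ts) hρc hρ'c hρpos hθ c hc
  have hst := hstab_relPath_two_of_hdisp F γ b₀ p₀ j Ts hjTs hχsupp Φ hθj c Db rc hrc hDb0 DP hDb hguard hdisp hroom
  intro B B' m m' U₁ V₁ W₂ hm hm' hU₁ hV₁ _hW₂ hVU hVB _hWU _hWB X hoff hon
  have hlip := hWlip B' m' V₁ X hm' hV₁ hoff hon
  refine ⟨fun _ => bW, fun _ => (M + M) * bW, integrable_const _, integrable_const _, hlip, ?_⟩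
  filter_upwards [hlip] with z hz
  refine lipschitzOnWith_const_mul_of_support hz fun hne => ?_
  obtain ⟨s₀, hs₀, hne⟩ := hne
  obtain ⟨hV, hU⟩ := hst z B B' m m' U₁ V₁ X hm hm' hU₁ hV₁ hVU hVB hoff hon s₀ (abs_le_two_of_mem_Ioo hs₀)
    (mwCut_ne_zero_of_wNum_ne_zero F γ b₀ p₀ j Ts ρ ρ' Φ J t (X s₀) z hne)
  exact (abs_sub _ _).trans (add_le_add (hM _ hV) (hM _ hU))

/-- ★★ **REG′ OF THE (I-law-V3)sq BLOCK FROM (W-Lip)** — same path binders; the conjunct `∃ (b bD bS bDS : Z → ℝ), …` VERBATIM (multipliers `ΔF`, `ΣF`, `ΔF·ΣF` at the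
corners `V₁, U₁`), with `b := bW`, `bD = bS := (M + M)·bW`, `bDS := ((M + M)·(M + M))·bW`. [folklore] -/
theorem ilawRegV3_of_weightLip (F : T3Family) (γ b₀ p₀ : ℝ) (j Ts : ℕ) (hjTs : j + 1 ≤ Ts)
    (ρ ρ' : (i : ℕ) → GaugeField (F.P i) 0 ↥(Matrix.specialUnitaryGroup (Fin 2) ℂ) → ℝ)
    (hρc : ContinuousOn (ρ Ts) {U | PlaqSmall (θBal F.L γ b₀ p₀ Ts) U}) (hρ'c : ContinuousOn (ρ' Ts) {U | PlaqSmall (θBal F.L γ b₀ p₀ Ts) U})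
    (hρpos : ∀ U, PlaqSmall (θBal F.L γ b₀ p₀ Ts) U → 0 < ρ Ts U ∧ 0 < ρ' Ts U)
    (hθ : 0 < θBal F.L γ b₀ p₀ Ts)
    (hχsupp : ∀ U, mwCut F γ b₀ p₀ j Ts U ≠ 0 → ∀ (n : ℕ) (hjn : j + 1 ≤ n) (hnK : n ≤ Ts), PlaqSmall (24 / 25 * θBal F.L γ b₀ p₀ n) (descendTo F ℰp n Ts hnK U))
    {Z : Type} [MeasurableSpace Z] (τ : Measure Z) [IsFiniteMeasure τ]
    (Φ : GaugeField (F.P j) 0 ↥(Matrix.specialUnitaryGroup (Fin 2) ℂ) × Z → GaugeField (F.P Ts) 0 ↥(Matrix.specialUnitaryGroup (Fin 2) ℂ))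
    (J : GaugeField (F.P j) 0 ↥(Matrix.specialUnitaryGroup (Fin 2) ℂ) × Z → ℝ≥0)
    (c : ℝ) (hc : c < 1)
    (hθj : 0 < θBal F.L γ b₀ p₀ j) (Db rc : ℝ) (hrc : 0 ≤ rc) (hDb0 : 0 ≤ Db) (DP : Plaq (F.P Ts) 0 → PBond (F.P j) 0 → ℝ) (hDb : ∀ p b, DP p b ≤ Db)
    (hguard : (1 + 16 * Real.sqrt 3 * rc) * (θBal F.L γ b₀ p₀ j / 4) ≤ θBal F.L γ b₀ p₀ j)
    (hdisp : ∀ (z : Z) (X : GaugeField (F.P j) 0 ↥(Matrix.specialUnitaryGroup (Fin 2) ℂ)), PlaqSmall (θBal F.L γ b₀ p₀ j) X →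
      ∀ (b : PBond (F.P j) 0) (v : Fin 3 → ℝ), ‖v‖ ≤ rc * (θBal F.L γ b₀ p₀ j / 4) → ∀ s ∈ Icc (0 : ℝ) 1, ∀ p : Plaq (F.P Ts) 0,
        dist1 (GaugeField.plaqHol (Φ (update X b (X b * expPt (s • v)), z)) p)
          ≤ dist1 (GaugeField.plaqHol (Φ (X, z)) p) + DP p b * (‖v‖ / (θBal F.L γ b₀ p₀ j / 4)))
    (hroom : 24 / 25 * θBal F.L γ b₀ p₀ Ts + 3 * (Db * rc) ≤ c * θBal F.L γ b₀ p₀ Ts) (t : ℝ) (bW : ℝ)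
    (hWlip : ∀ (B' : PBond (F.P j) 0) (m' : Fin 3 → ℝ) (U₂ : GaugeField (F.P j) 0 ↥(Matrix.specialUnitaryGroup (Fin 2) ℂ))
      (X : ℝ → GaugeField (F.P j) 0 ↥(Matrix.specialUnitaryGroup (Fin 2) ℂ)), ‖m'‖ ≤ rc * (θBal F.L γ b₀ p₀ j / 4) → PlaqSmall (θBal F.L γ b₀ p₀ j / 4) U₂ →
      (∀ s e, e ≠ B' → X s e = U₂ e) → (∀ s, X s B' = U₂ B' * expPt (s • m')) →
      ∀ᵐ z ∂τ, LipschitzOnWith (Real.nnabs bW) (fun s => wNum F γ b₀ p₀ j Ts ρ ρ' Φ J t (X s) z) (Set.Ioo (-1) 2)) :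
    ∀ (B B' : PBond (F.P j) 0) (m m' : Fin 3 → ℝ) (U₁ V₁ W₂ : GaugeField (F.P j) 0 ↥(Matrix.specialUnitaryGroup (Fin 2) ℂ)), ‖m‖ ≤ rc * (θBal F.L γ b₀ p₀ j / 4) → ‖m'‖ ≤ rc * (θBal F.L γ b₀ p₀ j / 4) → PlaqSmall (θBal F.L γ b₀ p₀ j / 4) U₁ → PlaqSmall (θBal F.L γ b₀ p₀ j / 4) V₁ → PlaqSmall (θBal F.L γ b₀ p₀ j / 4) W₂ → (∀ e, e ≠ B → V₁ e = U₁ e) → V₁ B = U₁ B * expPt m → (∀ e, e ≠ B' → W₂ e = V₁ e) → W₂ B' = V₁ B' * expPt m' → ∀ (X : ℝ → GaugeField (F.P j) 0 ↥(Matrix.specialUnitaryGroup (Fin 2) ℂ)), (∀ s e, e ≠ B' → X s e = V₁ e) → (∀ s, X s B' = V₁ B' * expPt (s • m')) →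
      (∃ (b bD bS bDS : Z → ℝ), Integrable b τ ∧ Integrable bD τ ∧ Integrable bS τ ∧ Integrable bDS τ ∧
        (∀ᵐ z ∂τ, LipschitzOnWith (Real.nnabs (b z)) (fun s => wNum F γ b₀ p₀ j Ts ρ ρ' Φ J t (X s) z) (Set.Ioo (-1) 2)) ∧
        (∀ᵐ z ∂τ, LipschitzOnWith (Real.nnabs (bD z)) (fun s => ((Real.log (ρ Ts (Φ (V₁, z))) - Real.log (ρ' Ts (Φ (V₁, z)))) - (Real.log (ρ Ts (Φ (U₁, z))) - Real.log (ρ' Ts (Φ (U₁, z))))) * wNum F γ b₀ p₀ j Ts ρ ρ' Φ J t (X s) z) (Set.Ioo (-1) 2)) ∧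
        (∀ᵐ z ∂τ, LipschitzOnWith (Real.nnabs (bS z)) (fun s => ((Real.log (ρ Ts (Φ (V₁, z))) - Real.log (ρ' Ts (Φ (V₁, z)))) + (Real.log (ρ Ts (Φ (U₁, z))) - Real.log (ρ' Ts (Φ (U₁, z))))) * wNum F γ b₀ p₀ j Ts ρ ρ' Φ J t (X s) z) (Set.Ioo (-1) 2)) ∧
        (∀ᵐ z ∂τ, LipschitzOnWith (Real.nnabs (bDS z)) (fun s => (((Real.log (ρ Ts (Φ (V₁, z))) - Real.log (ρ' Ts (Φ (V₁, z)))) - (Real.log (ρ Ts (Φ (U₁, z))) - Real.log (ρ' Ts (Φ (U₁, z))))) * ((Real.log (ρ Ts (Φ (V₁, z))) - Real.log (ρ' Ts (Φ (V₁, z)))) + (Real.log (ρ Ts (Φ (U₁, z))) - Real.log (ρ' Ts (Φ (U₁, z)))))) * wNum F γ b₀ p₀ j Ts ρ ρ' Φ J t (X s) z) (Set.Ioo (-1) 2))) := by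
  obtain ⟨M, hM⟩ := abs_logRatio_le_of_plaq_le F γ b₀ p₀ Ts (ρ Ts) (ρ' Ts) hρc hρ'c hρpos hθ c hc
  have hst := hstab_relPath_two_of_hdisp F γ b₀ p₀ j Ts hjTs hχsupp Φ hθj c Db rc hrc hDb0 DP hDb hguard hdisp hroom
  intro B B' m m' U₁ V₁ W₂ hm hm' hU₁ hV₁ _hW₂ hVU hVB _hWU _hWB X hoff hon
  have hlip := hWlip B' m' V₁ X hm' hV₁ hoff hon
  -- on the path support both value corners are in the closed window
  have hwin : ∀ z, (∃ s ∈ Set.Ioo (-1 : ℝ) 2, wNum F γ b₀ p₀ j Ts ρ ρ' Φ J t (X s) z ≠ 0) →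
      |Real.log (ρ Ts (Φ (V₁, z))) - Real.log (ρ' Ts (Φ (V₁, z)))| ≤ M ∧ |Real.log (ρ Ts (Φ (U₁, z))) - Real.log (ρ' Ts (Φ (U₁, z)))| ≤ M := by
    rintro z ⟨s₀, hs₀, hne⟩
    obtain ⟨hV, hU⟩ := hst z B B' m m' U₁ V₁ X hm hm' hU₁ hV₁ hVU hVB hoff hon s₀ (abs_le_two_of_mem_Ioo hs₀)
      (mwCut_ne_zero_of_wNum_ne_zero F γ b₀ p₀ j Ts ρ ρ' Φ J t (X s₀) z hne)
    exact ⟨hM _ hV, hM _ hU⟩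
  refine ⟨fun _ => bW, fun _ => (M + M) * bW, fun _ => (M + M) * bW, fun _ => ((M + M) * (M + M)) * bW,
    integrable_const _, integrable_const _, integrable_const _, integrable_const _, hlip, ?_, ?_, ?_⟩
  · filter_upwards [hlip] with z hz
    refine lipschitzOnWith_const_mul_of_support hz fun hne => ?_
    obtain ⟨hV, hU⟩ := hwin z hne
    exact (abs_sub _ _).trans (add_le_add hV hU)
  · filter_upwards [hlip] with z hz
    refine lipschitzOnWith_const_mul_of_support hz fun hne => ?_
    obtain ⟨hV, hU⟩ := hwin z hne
    exact (abs_add_le _ _).trans (add_le_add hV hU)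
  · filter_upwards [hlip] with z hz
    refine lipschitzOnWith_const_mul_of_support hz fun hne => ?_
    obtain ⟨hV, hU⟩ := hwin z hne
    rw [abs_mul]
    exact mul_le_mul ((abs_sub _ _).trans (add_le_add hV hU)) ((abs_add_le _ _).trans (add_le_add hV hU)) (abs_nonneg _)
      ((abs_nonneg _).trans ((abs_sub _ _).trans (add_le_add hV hU)))

/-- ★★ **REG′ OF THE (I-law-L) AND (I-law-V4) BLOCKS FROM (W-Lip)** (identical REG′ shape) — under the square binders (`B B′ m m′ V00 V10 V01 V11`, twelve admissibility
hypotheses, the relational square `(Y, X)` from `V00`), the conjunct `∃ (b bF bFF : Z → ℝ), …` VERBATIM (multipliers `F`, `F·F` at `V00`; Lipschitz in `s` along `s ↦ X s s′` for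
every `s′ ∈ Icc 0 1`), with `b := bW`, `bF := M·bW`, `bFF := (M·M)·bW`. [folklore] -/
theorem ilawRegSq_of_weightLip (F : T3Family) (γ b₀ p₀ : ℝ) (j Ts : ℕ) (hjTs : j + 1 ≤ Ts)
    (ρ ρ' : (i : ℕ) → GaugeField (F.P i) 0 ↥(Matrix.specialUnitaryGroup (Fin 2) ℂ) → ℝ)
    (hρc : ContinuousOn (ρ Ts) {U | PlaqSmall (θBal F.L γ b₀ p₀ Ts) U}) (hρ'c : ContinuousOn (ρ' Ts) {U | PlaqSmall (θBal F.L γ b₀ p₀ Ts) U})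
    (hρpos : ∀ U, PlaqSmall (θBal F.L γ b₀ p₀ Ts) U → 0 < ρ Ts U ∧ 0 < ρ' Ts U)
    (hθ : 0 < θBal F.L γ b₀ p₀ Ts)
    (hχsupp : ∀ U, mwCut F γ b₀ p₀ j Ts U ≠ 0 → ∀ (n : ℕ) (hjn : j + 1 ≤ n) (hnK : n ≤ Ts), PlaqSmall (24 / 25 * θBal F.L γ b₀ p₀ n) (descendTo F ℰp n Ts hnK U))
    {Z : Type} [MeasurableSpace Z] (τ : Measure Z) [IsFiniteMeasure τ]
    (Φ : GaugeField (F.P j) 0 ↥(Matrix.specialUnitaryGroup (Fin 2) ℂ) × Z → GaugeField (F.P Ts) 0 ↥(Matrix.specialUnitaryGroup (Fin 2) ℂ))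
    (J : GaugeField (F.P j) 0 ↥(Matrix.specialUnitaryGroup (Fin 2) ℂ) × Z → ℝ≥0)
    (c : ℝ) (hc : c < 1)
    (hθj : 0 < θBal F.L γ b₀ p₀ j) (Db rc : ℝ) (hrc : 0 ≤ rc) (hDb0 : 0 ≤ Db) (DP : Plaq (F.P Ts) 0 → PBond (F.P j) 0 → ℝ) (hDb : ∀ p b, DP p b ≤ Db)
    (hguard : (1 + 16 * Real.sqrt 3 * rc) * (θBal F.L γ b₀ p₀ j / 4) ≤ θBal F.L γ b₀ p₀ j)
    (hdisp : ∀ (z : Z) (X : GaugeField (F.P j) 0 ↥(Matrix.specialUnitaryGroup (Fin 2) ℂ)), PlaqSmall (θBal F.L γ b₀ p₀ j) X →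
      ∀ (b : PBond (F.P j) 0) (v : Fin 3 → ℝ), ‖v‖ ≤ rc * (θBal F.L γ b₀ p₀ j / 4) → ∀ s ∈ Icc (0 : ℝ) 1, ∀ p : Plaq (F.P Ts) 0,
        dist1 (GaugeField.plaqHol (Φ (update X b (X b * expPt (s • v)), z)) p)
          ≤ dist1 (GaugeField.plaqHol (Φ (X, z)) p) + DP p b * (‖v‖ / (θBal F.L γ b₀ p₀ j / 4)))
    (hroom : 24 / 25 * θBal F.L γ b₀ p₀ Ts + 3 * (Db * rc) ≤ c * θBal F.L γ b₀ p₀ Ts) (t : ℝ) (bW : ℝ)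
    (hWlipSq : ∀ (B B' : PBond (F.P j) 0) (m m' : Fin 3 → ℝ) (V00 : GaugeField (F.P j) 0 ↥(Matrix.specialUnitaryGroup (Fin 2) ℂ))
      (Y : ℝ → GaugeField (F.P j) 0 ↥(Matrix.specialUnitaryGroup (Fin 2) ℂ)) (X : ℝ → ℝ → GaugeField (F.P j) 0 ↥(Matrix.specialUnitaryGroup (Fin 2) ℂ)),
      ‖m‖ ≤ rc * (θBal F.L γ b₀ p₀ j / 4) → ‖m'‖ ≤ rc * (θBal F.L γ b₀ p₀ j / 4) → PlaqSmall (θBal F.L γ b₀ p₀ j / 4) V00 →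
      (∀ s e, e ≠ B → Y s e = V00 e) → (∀ s, Y s B = V00 B * expPt (s • m)) → (∀ s s' e, e ≠ B' → X s s' e = Y s e) → (∀ s s', X s s' B' = Y s B' * expPt (s' • m')) →
      ∀ s' ∈ Set.Icc (0:ℝ) 1, ∀ᵐ z ∂τ, LipschitzOnWith (Real.nnabs bW) (fun s => wNum F γ b₀ p₀ j Ts ρ ρ' Φ J t (X s s') z) (Set.Ioo (-1) 2)) :
    ∀ (B B' : PBond (F.P j) 0) (m m' : Fin 3 → ℝ) (V00 V10 V01 V11 : GaugeField (F.P j) 0 ↥(Matrix.specialUnitaryGroup (Fin 2) ℂ)), ‖m‖ ≤ rc * (θBal F.L γ b₀ p₀ j / 4) → ‖m'‖ ≤ rc * (θBal F.L γ b₀ p₀ j / 4) → PlaqSmall (θBal F.L γ b₀ p₀ j / 4) V00 → PlaqSmall (θBal F.L γ b₀ p₀ j / 4) V10 → PlaqSmall (θBal F.L γ b₀ p₀ j / 4) V01 → PlaqSmall (θBal F.L γ b₀ p₀ j / 4) V11 → (∀ e, e ≠ B → V10 e = V00 e) → V10 B = V00 B * expPt m → (∀ e, e ≠ B' → V01 e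 = V00 e) → V01 B' = V00 B' * expPt m' → (∀ e, e ≠ B' → V11 e = V10 e) → V11 B' = V10 B' * expPt m' → ∀ (Y : ℝ → GaugeField (F.P j) 0 ↥(Matrix.specialUnitaryGroup (Fin 2) ℂ)) (X : ℝ → ℝ → GaugeField (F.P j) 0 ↥(Matrix.specialUnitaryGroup (Fin 2) ℂ)), (∀ s e, e ≠ B → Y s e = V00 e) → (∀ s, Y s B = V00 B * expPt (s • m)) → (∀ s s' e, e ≠ B' → X s s' e = Y s e) → (∀ s s', X s s' B' = Y s B' * expPt (s' • m')) →
      (∃ (b bF bFF : Z → ℝ), Integrable b τ ∧ Integrable bF τ ∧ Integrable bFF τ ∧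
        (∀ s' ∈ Set.Icc (0:ℝ) 1, ∀ᵐ z ∂τ, LipschitzOnWith (Real.nnabs (b z)) (fun s => wNum F γ b₀ p₀ j Ts ρ ρ' Φ J t (X s s') z) (Set.Ioo (-1) 2)) ∧
        (∀ s' ∈ Set.Icc (0:ℝ) 1, ∀ᵐ z ∂τ, LipschitzOnWith (Real.nnabs (bF z)) (fun s => (Real.log (ρ Ts (Φ (V00, z))) - Real.log (ρ' Ts (Φ (V00, z)))) * wNum F γ b₀ p₀ j Ts ρ ρ' Φ J t (X s s') z) (Set.Ioo (-1) 2)) ∧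
        (∀ s' ∈ Set.Icc (0:ℝ) 1, ∀ᵐ z ∂τ, LipschitzOnWith (Real.nnabs (bFF z)) (fun s => ((Real.log (ρ Ts (Φ (V00, z))) - Real.log (ρ' Ts (Φ (V00, z)))) * (Real.log (ρ Ts (Φ (V00, z))) - Real.log (ρ' Ts (Φ (V00, z))))) * wNum F γ b₀ p₀ j Ts ρ ρ' Φ J t (X s s') z) (Set.Ioo (-1) 2))) := by
  obtain ⟨M, hM⟩ := abs_logRatio_le_of_plaq_le F γ b₀ p₀ Ts (ρ Ts) (ρ' Ts) hρc hρ'c hρpos hθ c hc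
  have hst := hstab_relSquare_two_of_hdisp F γ b₀ p₀ j Ts hjTs hχsupp Φ hθj c Db rc hrc hDb0 DP hDb hguard hdisp hroom
  intro B B' m m' V00 V10 V01 V11 hm hm' h00 _h10 _h01 _h11 _h10off _h10on _h01off _h01on _h11off _h11on Y X hYoff hYon hXoff hXon
  have hlip := hWlipSq B B' m m' V00 Y X hm hm' h00 hYoff hYon hXoff hXon
  have hwin : ∀ s' ∈ Set.Icc (0 : ℝ) 1, ∀ z, (∃ s ∈ Set.Ioo (-1 : ℝ) 2, wNum F γ b₀ p₀ j Ts ρ ρ' Φ J t (X s s') z ≠ 0) →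
      |Real.log (ρ Ts (Φ (V00, z))) - Real.log (ρ' Ts (Φ (V00, z)))| ≤ M := by
    rintro s' hs' z ⟨s₀, hs₀, hne⟩
    exact hM _ (hst z B B' m m' V00 Y X hm hm' h00 hYoff hYon hXoff hXon s₀ (abs_le_two_of_mem_Ioo hs₀) s' hs'
      (mwCut_ne_zero_of_wNum_ne_zero F γ b₀ p₀ j Ts ρ ρ' Φ J t (X s₀ s') z hne))
  refine ⟨fun _ => bW, fun _ => M * bW, fun _ => (M * M) * bW, integrable_const _, integrable_const _, integrable_const _, hlip, ?_, ?_⟩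
  · intro s' hs'
    filter_upwards [hlip s' hs'] with z hz
    exact lipschitzOnWith_const_mul_of_support hz (hwin s' hs' z)
  · intro s' hs'
    filter_upwards [hlip s' hs'] with z hz
    refine lipschitzOnWith_const_mul_of_support hz fun hne => ?_
    have h := hwin s' hs' z hne
    rw [abs_mul]
    exact mul_le_mul h h (abs_nonneg _) ((abs_nonneg _).trans h)

end Dischargers

end Summit.QuantumFields.YangMills.Theorems.OrganTangentILawRegOfWeightLip

end
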